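import Literature.Analysis.FluidPDE.NSBoundedMildOseen
import Literature.Analysis.FluidPDE.SuitableWeak
import HarnessLib

/-!
# Albritton–Barker 2019 (ARMA), Theorem 4.1: blow-up criteria in the endpoint critical Besov space
# `Ḃ^{-1+3/p}_{p,∞}` — a small `Ḃ^{-1}_{∞,∞}` profile at the blow-up time forbids blow-up, and a
# profile in the class `𝔹` (vanishing zoom) forbids a singularity, under `Ḃ^{s_p}_{p,∞}` control

Topic `Analysis/FluidPDE`. Source: D. Albritton, T. Barker, *Global weak Besov solutions of the
Navier–Stokes equations and applications*, Arch. Ration. Mech. Anal. 232 (2019) 197–263 =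
arXiv:1802.03164 [`AlbrittonBarker2019ARMA`]; read in the arXiv version (held text
`paper:arxiv-1802.03164`): §1.1.1 (Cor. 1.8 and the footnoted definition of "regular at
`(x*,T*)`": "`v ∈ L^∞(B(x*,R) × ]T*−R²,T*[)` for some `R > 0`"), §2 (p. 9: the heat-kernel
characterization "for all `s ∈ ]−∞,0[` there exists `c = c(s) > 0` such that
`c⁻¹ sup_{t>0} t^{−s/2}‖S(t)f‖_{L^p} ≤ ‖f‖_{Ḃ^s_{p,∞}} ≤ c sup_{t>0} t^{−s/2}‖S(t)f‖_{L^p}`", the Kato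
spaces `𝒦^s_p`), §3.5 Def. 3.19 (mild solutions: `v ∈ 𝒳_T` with `v(·,t) = P₀(u₀,F)(·,t) − B(v,v)(·,t)`
for a.e. `t`), §4.1 (p. 25: the class `𝔹`, **Theorem 4.1**). One file for §4.1 (D-0064). This is
the "application to blow-up criteria" of the paper; the Liouville theorem of the JMFM companion
(arXiv:1811.00502, Thm. 4.1) is the tree's `AlbrittonBarker2019_liouville_weakL3_backward`, whose
rendering devices (heat-kernel form of `Ḃ^{-1}_{∞,∞}`, the class `𝔹` through the Navier–Stokes
zoom tested against smooth compactly supported fields) are reused verbatim.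

## The printed statement (unit viscosity)

§4.1: "Let `𝔹` denote the set of all divergence-free vector fields `f ∈ Ḃ^{-1}_{∞,∞}(ℝ³)` satisfying
`lim_{λ↓0} λf(λ(·)) = 0` in `𝒟'(ℝ³)`. Note that `𝔹` does not contain any non-trivial scale-invariant
vector fields." **Theorem 4.1** (Blow-up criteria). "Let `T* > 0`, `u₀ ∈ L^∞(ℝ³)` be a
divergence-free vector field, and `F ∈ L^∞_t L^q_x(ℝ³ × ]0,T*[)` for some `q ∈ ]3,∞[`. Suppose that
`v ∈ L^∞(ℝ³ × ]0,T[)` is a mild solution of the Navier–Stokes equations on `ℝ³ × ]0,T[` with initial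
data `u₀` and forcing term `div F` for all `T ∈ ]0,T*[`. Let `p ∈ ]3,∞[` and `M > 0`. There exists a
constant `ε := ε(p,q,M) > 0` with the following properties:
(i) Suppose that `‖v(·,t₁)‖_{Ḃ^{-1+3/p}_{p,∞}} ≤ M` for some `t₁ ∈ ]0,T*[` [footnote: `v(·,t)` is
well-defined for each `t ∈ [0,T*]` since `v` belongs to `C([0,T*]; 𝒟'(ℝ³))`]. If also
`‖v(·,T*)‖_{Ḃ^{-1}_{∞,∞}} + ‖F‖_{𝓕_q(ℝ³ × ]0,T*[)} ≤ ε`, then `v ∈ L^∞(ℝ³ × ]0,T*[)`.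
(ii) Suppose that there exists a sequence of times `t_n ↑ T*` such that
`sup_n ‖v(·,t_n)‖_{Ḃ^{-1+3/p}_{p,∞}} ≤ M`. If there exists `x* ∈ ℝ³` such that `v(·,T*)` satisfies
`dist(v(·+x*,T*), 𝔹) ≤ ε`, where the distance is measured in the `Ḃ^{-1}_{∞,∞}` norm, then `v` is
regular at `(x*,T*)`. If [this] is satisfied for all `x* ∈ ℝ³`, then `v ∈ L^∞(ℝ³ × ]0,T*[)`."
(Cor. 1.8 of §1.1.1 is the authors' "special case" of (ii); remark after it: "If `v(·,T*)` belongs to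
the closure of Schwartz functions in `Ḃ^{-1}_{∞,∞}`, then [the vanishing-zoom assumption] is
automatically satisfied.")

## Contents (named facts, D-0014) — the UNFORCED case `F = 0`

* `albrittonBarker2019_bounded_of_small_profile` — Theorem 4.1 (i).
* `albrittonBarker2019_regular_of_vanishing_zoom` — Theorem 4.1 (ii), first assertion, in the case
  `v(·+x*,T*) ∈ 𝔹` (distance `0 ≤ ε`).
* `albrittonBarker2019_bounded_of_vanishing_zoom_everywhere` — Theorem 4.1 (ii), last assertion,
  same case.

## Transcription notes (never stronger than print)

* *Forcing.* Only `F = 0` is recorded (then `‖F‖_{𝓕_q} = 0` and the exponent `q` is idle; `ε`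
  depends on `p`, `M` — and on the fixed idle `q`, absorbed).
* *Mild solution in `L^∞(ℝ³ × ]0,T[)` for all `T < T*` (Def. 3.19 with `u₀ ∈ L^∞`)* = the tree's
  pointwise Duhamel identity `v t x = e^{νtΔ}(v 0)(x) − B^ν_0(v,v)(t)(x)` for `0 < t < T*`
  (`UnboundedOperators.heatExtension`, `oseenDuhamel`, as in `barkerPrange2021_typeI_log_rate`), the
  datum being the slice `v 0 = u₀` (bounded, weakly divergence free), with `v` jointly measurable and
  bounded on every `[0,T] × ℝ³`, `T < T*`. A bounded field with bounded datum lies in `𝒳_T`, and an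
  everywhere identity implies the a.e. one, so this class is contained in the printed one.
* *`v(·,T*)`* — the value at `T*` of `v ∈ C([0,T*]; 𝒟')` — is rendered by a field `vT : ℝ³ → ℝ³`
  together with the hypothesis that the slices converge to it in `𝒟'`:
  `∫⟪v(t,x), φ(x)⟫dx → ∫⟪vT(x), φ(x)⟫dx` as `t ↑ T*` for every smooth compactly supported `φ`
  (so `vT` IS the printed `v(·,T*)`; when no such locally integrable representative exists the
  facts are vacuous, hence safe).
* *Besov quantities in heat-kernel form* (the paper's own characterization, §2 p. 9, constants
  `c(s)`; and `𝒦^s_p`): `‖f‖_{Ḃ^{s_p}_{p,∞}} ≤ M`, `s_p = −1+3/p`, is rendered as the Kato-type bound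
  `sup_{s>0} s^{(1−3/p)/2} ‖e^{sΔ}f‖_{L^p} ≤ M`, and `‖g‖_{Ḃ^{-1}_{∞,∞}} ≤ ε` as
  `sup_{s>0} √s ‖e^{sΔ}g‖_{L^∞} ≤ ε` (everywhere bound on the caloric extension). Since the printed
  statement reads "for every `M` there is `ε(p,M)`", the equivalence constants are absorbed: from the
  rendered hypotheses with `(M, ε')` one gets the printed ones with `(c M, c ε')`, so choosing
  `ε' = ε(p, cM)/c` the rendered facts follow from print. Same device as
  `AlbrittonBarker2019_liouville_weakL3_backward` (heat form of `Ḃ^{-1}_{∞,∞}`, BCD Thm. 2.34).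
* *The class `𝔹` and the distance condition.* Only the case `dist = 0` realised by MEMBERSHIP
  `v(·+x*,T*) ∈ 𝔹` is recorded: `vT` weakly divergence free, `sup_{s>0} √s‖e^{sΔ}vT‖_∞ < ∞`
  (`vT ∈ Ḃ^{-1}_{∞,∞}`), and the zoom at `x*` vanishes in `𝒟'`:
  `∫⟪λ vT(x* + λy), φ(y)⟫dy → 0` as `λ → 0⁺` for every smooth compactly supported `φ` (the
  Navier–Stokes rescaling `λf(λ·)` of the translate `f = vT(· + x*)`). -- TODO(general form): the
  `ε(p,M)`-neighbourhood of `𝔹` in `Ḃ^{-1}_{∞,∞}` (needs a Besov distance on slices).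
* *Conclusions.* "`v ∈ L^∞(ℝ³ × ]0,T*[)`" = essential boundedness of `uncurry v` on
  `(0,T*) × ℝ³`; "regular at `(x*,T*)`" = essential boundedness on some backward cylinder
  `parabolicCylinder R (T*,x*) = (T*−R², T*) × B_R(x*)`, `R > 0` (the footnoted definition).
* *Viscosity.* Printed for `ν = 1`; recorded for `ν > 0` via `w(y,s) = ν⁻¹v(y,s/ν)` (unit viscosity;
  the heat-semigroup parameter is a spatial scale and is not rescaled, so the Kato/heat bounds of
  the slices of `w` are `ν⁻¹` times those of `v`: hypotheses `≤ νM`, `≤ νε`; the Duhamel identity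
  with `e^{νtΔ}`, `B^ν_0`; boundedness, regularity, `𝔹`-membership unchanged).
* Not here: Cor. 1.8 as printed separately (its zoom hypothesis along the sequence `√(T*−t_n)` —
  the case recorded here assumes the full limit `λ → 0⁺`, a stronger hypothesis), Thms 1.1–1.3,
  Cor. 1.10, Thm 1.11, §§2–3, 4.2–6, the forced case.

## Mathlib / tree search

`lean search 'AlbrittonBarker2019ARMA|1802.03164|vanishing_zoom|small_profile'`: the key was cited by
no Literature declaration (2026-08-26; the JMFM companion's Liouville theorem is
`AlbrittonBarker2019_liouville_(weak)L3_backward`). Nearby DEPRECATED/mis-stated Besov criteria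
(`albritton_besov_blowup`, `albritton_singular_point_of_blowup`, `gkp_besov_blowup`,
`CriticalRegularity.lean` ll. 555–601) concern Albritton 2018 / GKP 2016 over Besov-valued mild
classes; the present facts avoid those classes altogether (bounded mild solutions with `L^∞` data,
Besov control only through the printed heat-kernel quantities). Reused: `oseenDuhamel`,
`UnboundedOperators.heatExtension`, `IsBoundedOn`, `IsWeaklyDivFree`, `parabolicCylinder`,
`FunctionSpaces.IsTestFunctionOn`.

## References

* D. Albritton, T. Barker, ARMA 232 (2019) = arXiv:1802.03164: §1.1.1 (Cor. 1.8, footnote), §2 p. 9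
  (heat-kernel characterization, `𝒦^s_p`), Def. 3.19, §4.1 p. 25 (`𝔹`, Thm. 4.1).
  [`AlbrittonBarker2019ARMA`]
* H. Bahouri, J.-Y. Chemin, R. Danchin, *Fourier analysis and nonlinear PDE* (2011), Thm. 2.34.
-/

noncomputable section

open MeasureTheory Set Function Metric Filter
open _root_.Topology
open scoped ENNReal RealInnerProductSpace

namespace Literature.Analysis.FluidPDE

/-- **Albritton–Barker 2019, Theorem 4.1 (i) (unforced): a quantitatively small `Ḃ^{-1}_{∞,∞}`
profile at the potential blow-up time, together with one `Ḃ^{-1+3/p}_{p,∞}`-bounded slice, forbids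
blow-up.** For every `p ∈ (3,∞)` and `M > 0` there is `ε = ε(p,M) > 0` such that for every
viscosity `ν > 0` and `T = T* > 0`: let `v` be a bounded mild solution of the unforced Navier–Stokes
equations on every `[0,T'] × ℝ³`, `T' < T` — jointly measurable, bounded on each `[0,T']`, with
bounded weakly divergence-free datum `v 0` and `v(t) = e^{νtΔ}v(0) − B^ν_0(v,v)(t)` pointwise for
`0 < t < T` —; let `vT` be its distributional value at `T` (`∫⟪v(t),φ⟫ → ∫⟪vT,φ⟫` as `t ↑ T` for all
test fields `φ`). If some slice `v(t₁)`, `0 < t₁ < T`, has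
`sup_{s>0} s^{(1−3/p)/2}‖e^{sΔ}v(t₁)‖_{L^p} ≤ νM` (the heat-kernel form of `‖v(t₁)‖_{Ḃ^{-1+3/p}_{p,∞}}`)
and the profile has `√s |e^{sΔ}vT(x)| ≤ νε` for all `s > 0`, `x` (the heat-kernel form of
`‖v(·,T*)‖_{Ḃ^{-1}_{∞,∞}} ≤ ε`), then `v` is essentially bounded on `(0,T) × ℝ³` — no blow-up at `T`.
Printed for `ν = 1` with the Besov norms themselves and a forcing `div F` (here `F = 0`); the
equivalence constants of the paper's heat-kernel characterization are absorbed in `ε` (module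
docstring). [cite: AlbrittonBarker2019ARMA, Thm. 4.1 (i) (arXiv:1802.03164 §4.1 p. 25; §2 p. 9)] -/
def albrittonBarker2019_bounded_of_small_profile : Prop :=
  ∀ (p : ℝ≥0∞), 3 < p → p < ∞ → ∀ M : ℝ, 0 < M → ∃ ε : ℝ, 0 < ε ∧
    ∀ (ν T : ℝ), 0 < ν → 0 < T →
      ∀ (v : ℝ → EuclideanSpace ℝ (Fin 3) → EuclideanSpace ℝ (Fin 3))
        (vT : EuclideanSpace ℝ (Fin 3) → EuclideanSpace ℝ (Fin 3)),
        AEStronglyMeasurable (uncurry v) (volume.restrict (Ico 0 T ×ˢ univ)) →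
        (∀ T' ∈ Ioo 0 T, IsBoundedOn (Icc 0 T') v) →
        IsWeaklyDivFree (v 0) →
        (∀ t ∈ Ioo 0 T, ∀ x,
          v t x = UnboundedOperators.heatExtension (v 0) (ν * t) x - oseenDuhamel ν 0 v v t x) →
        (∀ φ : EuclideanSpace ℝ (Fin 3) → EuclideanSpace ℝ (Fin 3),
          FunctionSpaces.IsTestFunctionOn
            (⊤ : TopologicalSpace.Opens (EuclideanSpace ℝ (Fin 3))) φ →
          Tendsto (fun t => ∫ x, ⟪v t x, φ x⟫) (𝓝[<] T) (𝓝 (∫ x, ⟪vT x, φ x⟫))) →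
        (∃ t₁ ∈ Ioo 0 T, ∀ s : ℝ, 0 < s →
          ENNReal.ofReal (s ^ ((1 - 3 / p.toReal) / 2)) *
              eLpNorm (UnboundedOperators.heatExtension (v t₁) s) p volume ≤
            ENNReal.ofReal (ν * M)) →
        (∀ s : ℝ, 0 < s → ∀ x,
          Real.sqrt s * ‖UnboundedOperators.heatExtension vT s x‖ ≤ ν * ε) →
        eLpNorm (uncurry v) ∞ (volume.restrict (Ioo 0 T ×ˢ univ)) < ∞

/-- **Albritton–Barker 2019, Theorem 4.1 (ii), first assertion (unforced, profile in `𝔹`): a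
blow-up profile whose zoom at `x*` vanishes is regular at `x*`, under `Ḃ^{-1+3/p}_{p,∞}` control
along a sequence of times.** For every `p ∈ (3,∞)`, `ν > 0`, `T > 0`: let `v` be a bounded mild
solution of the unforced Navier–Stokes equations on every `[0,T'] × ℝ³`, `T' < T` (as in
`albrittonBarker2019_bounded_of_small_profile`), with distributional value `vT` at `T`; suppose
that along some times `t_n ↑ T` the slices obey
`sup_n sup_{s>0} s^{(1−3/p)/2}‖e^{sΔ}v(t_n)‖_{L^p} ≤ νM` for some `M` (heat-kernel form of
`sup_n ‖v(·,t_n)‖_{Ḃ^{-1+3/p}_{p,∞}} ≤ M`), and that the translate `vT(· + x*)` lies in the class `𝔹`: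
`vT` is weakly divergence free, `sup_{s>0} √s‖e^{sΔ}vT‖_∞ < ∞` (`vT ∈ Ḃ^{-1}_{∞,∞}`), and
`λ vT(x* + λ·) → 0` in `𝒟'` as `λ → 0⁺`. Then `v` is **regular at `(x*,T)`**: essentially bounded on
some backward cylinder `(T−R², T) × B_R(x*)`, `R > 0`. Printed for `ν = 1` with forcing `div F` and
the weaker hypothesis `dist_{Ḃ^{-1}_{∞,∞}}(v(·+x*,T*), 𝔹) ≤ ε(p,q,M)` (here: distance `0` by
membership; `F = 0`; heat-kernel forms with absorbed constants — module docstring). [cite: AlbrittonBarker2019ARMA, Thm. 4.1 (ii) (arXiv:1802.03164 §4.1 p. 25; Cor. 1.8 §1.1.1)] -/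
def albrittonBarker2019_regular_of_vanishing_zoom : Prop :=
  ∀ (p : ℝ≥0∞), 3 < p → p < ∞ → ∀ (ν T : ℝ), 0 < ν → 0 < T →
    ∀ (v : ℝ → EuclideanSpace ℝ (Fin 3) → EuclideanSpace ℝ (Fin 3))
      (vT : EuclideanSpace ℝ (Fin 3) → EuclideanSpace ℝ (Fin 3)),
      AEStronglyMeasurable (uncurry v) (volume.restrict (Ico 0 T ×ˢ univ)) →
      (∀ T' ∈ Ioo 0 T, IsBoundedOn (Icc 0 T') v) →
      IsWeaklyDivFree (v 0) →
      (∀ t ∈ Ioo 0 T, ∀ x,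
        v t x = UnboundedOperators.heatExtension (v 0) (ν * t) x - oseenDuhamel ν 0 v v t x) →
      (∀ φ : EuclideanSpace ℝ (Fin 3) → EuclideanSpace ℝ (Fin 3),
        FunctionSpaces.IsTestFunctionOn
          (⊤ : TopologicalSpace.Opens (EuclideanSpace ℝ (Fin 3))) φ →
        Tendsto (fun t => ∫ x, ⟪v t x, φ x⟫) (𝓝[<] T) (𝓝 (∫ x, ⟪vT x, φ x⟫))) →
      (∃ (tseq : ℕ → ℝ) (M : ℝ), (∀ n, tseq n ∈ Ioo 0 T) ∧ StrictMono tseq ∧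
        Tendsto tseq atTop (𝓝 T) ∧
        ∀ (n : ℕ) (s : ℝ), 0 < s →
          ENNReal.ofReal (s ^ ((1 - 3 / p.toReal) / 2)) *
              eLpNorm (UnboundedOperators.heatExtension (v (tseq n)) s) p volume ≤
            ENNReal.ofReal (ν * M)) →
      IsWeaklyDivFree vT →
      (∃ A : ℝ, ∀ s : ℝ, 0 < s → ∀ x,
        Real.sqrt s * ‖UnboundedOperators.heatExtension vT s x‖ ≤ A) →
      ∀ xStar : EuclideanSpace ℝ (Fin 3),
        (∀ φ : EuclideanSpace ℝ (Fin 3) → EuclideanSpace ℝ (Fin 3),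
          FunctionSpaces.IsTestFunctionOn
            (⊤ : TopologicalSpace.Opens (EuclideanSpace ℝ (Fin 3))) φ →
          Tendsto (fun lam : ℝ => ∫ y, ⟪lam • vT (xStar + lam • y), φ y⟫) (𝓝[>] 0) (𝓝 0)) →
        ∃ R : ℝ, 0 < R ∧
          eLpNorm (uncurry v) ∞ (volume.restrict (parabolicCylinder R (T, xStar))) < ∞

/-- **Albritton–Barker 2019, Theorem 4.1 (ii), last assertion (unforced, profile in `𝔹` at every
point): no blow-up at `T`.** In the setting of `albrittonBarker2019_regular_of_vanishing_zoom`, if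
the zoom of the profile vanishes at EVERY `x* ∈ ℝ³` (`λ vT(x* + λ·) → 0` in `𝒟'` as `λ → 0⁺` for all
`x*`), then `v` is essentially bounded on `(0,T) × ℝ³`. Printed: "If (4.3) is satisfied for all
`x* ∈ ℝ³`, then `v ∈ L^∞(ℝ³ × ]0,T*[)`" (`ν = 1`, forcing `div F`, distance `≤ ε`; here `F = 0`,
membership, general `ν` — module docstring). [cite: AlbrittonBarker2019ARMA, Thm. 4.1 (ii) (arXiv:1802.03164 §4.1 p. 25)] -/
def albrittonBarker2019_bounded_of_vanishing_zoom_everywhere : Prop :=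
  ∀ (p : ℝ≥0∞), 3 < p → p < ∞ → ∀ (ν T : ℝ), 0 < ν → 0 < T →
    ∀ (v : ℝ → EuclideanSpace ℝ (Fin 3) → EuclideanSpace ℝ (Fin 3))
      (vT : EuclideanSpace ℝ (Fin 3) → EuclideanSpace ℝ (Fin 3)),
      AEStronglyMeasurable (uncurry v) (volume.restrict (Ico 0 T ×ˢ univ)) →
      (∀ T' ∈ Ioo 0 T, IsBoundedOn (Icc 0 T') v) →
      IsWeaklyDivFree (v 0) →
      (∀ t ∈ Ioo 0 T, ∀ x,
        v t x = UnboundedOperators.heatExtension (v 0) (ν * t) x - oseenDuhamel ν 0 v v t x) →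
      (∀ φ : EuclideanSpace ℝ (Fin 3) → EuclideanSpace ℝ (Fin 3),
        FunctionSpaces.IsTestFunctionOn
          (⊤ : TopologicalSpace.Opens (EuclideanSpace ℝ (Fin 3))) φ →
        Tendsto (fun t => ∫ x, ⟪v t x, φ x⟫) (𝓝[<] T) (𝓝 (∫ x, ⟪vT x, φ x⟫))) →
      (∃ (tseq : ℕ → ℝ) (M : ℝ), (∀ n, tseq n ∈ Ioo 0 T) ∧ StrictMono tseq ∧
        Tendsto tseq atTop (𝓝 T) ∧
        ∀ (n : ℕ) (s : ℝ), 0 < s →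
          ENNReal.ofReal (s ^ ((1 - 3 / p.toReal) / 2)) *
              eLpNorm (UnboundedOperators.heatExtension (v (tseq n)) s) p volume ≤
            ENNReal.ofReal (ν * M)) →
      IsWeaklyDivFree vT →
      (∃ A : ℝ, ∀ s : ℝ, 0 < s → ∀ x,
        Real.sqrt s * ‖UnboundedOperators.heatExtension vT s x‖ ≤ A) →
      (∀ (xStar : EuclideanSpace ℝ (Fin 3))
        (φ : EuclideanSpace ℝ (Fin 3) → EuclideanSpace ℝ (Fin 3)),
        FunctionSpaces.IsTestFunctionOn
          (⊤ : TopologicalSpace.Opens (EuclideanSpace ℝ (Fin 3))) φ →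
        Tendsto (fun lam : ℝ => ∫ y, ⟪lam • vT (xStar + lam • y), φ y⟫) (𝓝[>] 0) (𝓝 0)) →
      eLpNorm (uncurry v) ∞ (volume.restrict (Ioo 0 T ×ˢ univ)) < ∞

end Literature.Analysis.FluidPDE

end
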